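import Summits.BirchSwinnertonDyer.BirchSwinnertonDyer.Theorems.SylvesterTwoHeegnerIndexCoupledTelescopeLagrangian
import Literature.GroupTheory.FiniteAbelian.SymplecticModules
import HarnessLib

/-!
# The COUPLED Cassels–Tate telescope, VIII′: the descended Lagrangian for a GIVEN pairing witness
# (GENERIC-WITNESS form of `…CoupledTelescopeLagrangianSha`, planner D584/D586)

Crux `UpperOffV0HSYPlus` (stmt-BirchSwinnertonDyer-19804); census theorems p699147 / p699428 (hT's
(T-L4)).  `…CoupledTelescopeLagrangianSha.exists_coisotropic_lagrangian_sha` (p700369) produces the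
(T-L4) Lagrangian from the `∃`-fact `casselsTate_pairing_resCor` — but the planner's DISCHARGE RULING
(D584/D586, after k-ty1 g11's report) is that ALL of hT's pairing leaves (hCTV, hiso, (coiso), (gen) and
the descent's `B_K`) must be carried by ONE pairing, and only the CONSTRUCTED
`ctLevelPairing … canonical` can also carry the value leaves; an `∃ B₂` output is undischargeable
against hCTV.  Hence the brick of record must be GENERIC IN THE PAIRING WITNESS: the pairings
`Bℚ₂, B₂`, the descent maps `r, w` and EXACTLY the properties consumed are BINDERS, and the output is
the Lagrangian `L` with `D := closure (r(L) ∪ w '' r(L))` isotropic and coisotropic FOR THE GIVEN `B₂`.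
This file is that form (pure algebra over `…CoupledTelescopeLagrangian` + the tree's symplectic
structure theorem `FiniteAbelian.exists_lagrangian_sq_eq_card`):

* `exists_coisotropic_lagrangian_of_package` — for additive groups `M₀` (finite, `2`-primary) and `M`,
  bi-additive `Bℚ₂ : M₀ → M₀ → ℚ/ℤ` alternating and non-degenerate, `B₂ : M → M → ℚ/ℤ` with the
  `𝒪`-balance `B₂ (w a) b = B₂ a (-b - w b)`, `w² + w + 1 = 0`, `r : M₀ → M` with (CT-3′)
  `B₂ (r a) (r b) = 2 • Bℚ₂ a b`, `B₂ (r a) (w (r b)) = -(Bℚ₂ a b)`, and descent surjectivity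
  `∀ m, ∃ c d, m = r c + w (r d)`: **`∃ L ≤ M₀`, `(#L)² = #M₀`, and `closure (r(L) ∪ w '' r(L))` is
  isotropic and coisotropic for `B₂`.**

The p700369 theorem is the COROLLARY of this one at the `∃`-package `exists_casselsTate_resCor_package`
+ #K7 (kept as landed; not the brick of record).  Next consumer: `B₂ :=` (K-a)'s `B_X` on
`ctLevelPairing (X.baseChange K) (2^k) … canonical` (k-ty1 g11 #27), properties from (K-b).
Theorem-only (no definition, no named fact); nothing asserted on 19804; BSD not claimed for any curve.
Sources: McCallum 1991 §5 p. 288; MEMO-bsd-cm-two §59.1 (iii), §64.5; Wall 1963 / Tignol–Amitsur 1986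
(symplectic modules, via the tree).
-/

-- every Summits module is named `Summit.<Summit>.<Problem>…`: the duplicated component is by design
set_option linter.dupNamespace false
set_option autoImplicit false

open scoped Classical

namespace Summit.BirchSwinnertonDyer.BirchSwinnertonDyer.Theorems.SylvesterTwoCoupledTelescope

section Package

variable {M₀ M : Type*} [AddCommGroup M₀] [AddCommGroup M]

/-- **The descended Lagrangian for a GIVEN pairing witness** (generic-witness form, planner D586 (2)):
pairings `Bℚ₂`, `B₂`, descent maps `r`, `w` and their consumed properties as binders ⊢ a Lagrangian
`L` of `(M₀, Bℚ₂)` with `(#L)² = #M₀` whose descended `𝒪`-span `closure (r(L) ∪ w '' r(L))` is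
ISOTROPIC and COISOTROPIC for `B₂` (McCallum p. 288 «choose a maximal isotropic subgroup `D`», realised
as `D₀ ⊗ 𝒪`; memo two §59.1 (iii)). [cite: McCallumLMS1991, §5 (p. 288)]
[cite: TignolAmitsur1986SymplecticModules, Thm. 4.1] -/
theorem exists_coisotropic_lagrangian_of_package [Finite M₀]
    (Bℚ₂ : M₀ →+ M₀ →+ AddCircle (1 : ℚ)) (B₂ : M →+ M →+ AddCircle (1 : ℚ)) (r : M₀ →+ M)
    (w : M →+ M) (haltℚ : ∀ a, Bℚ₂ a a = 0) (hndℚ : ∀ a, (∀ b, Bℚ₂ a b = 0) → a = 0)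
    (hwrel : ∀ x, w (w x) + w x + x = 0) (hbal : ∀ a b, B₂ (w a) b = B₂ a (-b - w b))
    (h2B : ∀ a b, B₂ (r a) (r b) = (2 : ℤ) • Bℚ₂ a b) (hwB : ∀ a b, B₂ (r a) (w (r b)) = -(Bℚ₂ a b))
    (hsurj : ∀ m : M, ∃ c d : M₀, m = r c + w (r d))
    (hprim : ∀ c : M₀, ∃ k : ℕ, ((2 : ℤ) ^ k) • c = 0) :
    ∃ L : AddSubgroup M₀, Nat.card L ^ 2 = Nat.card M₀ ∧
      (∀ s ∈ AddSubgroup.closure ((r '' (L : Set M₀)) ∪ w '' (r '' (L : Set M₀))),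
        ∀ t ∈ AddSubgroup.closure ((r '' (L : Set M₀)) ∪ w '' (r '' (L : Set M₀))), B₂ s t = 0) ∧
      (∀ t, (∀ s ∈ AddSubgroup.closure ((r '' (L : Set M₀)) ∪ w '' (r '' (L : Set M₀))), B₂ t s = 0) →
        t ∈ AddSubgroup.closure ((r '' (L : Set M₀)) ∪ w '' (r '' (L : Set M₀)))) := by
  obtain ⟨L, hLiso, hLco, hLcard⟩ :=
    Literature.GroupTheory.FiniteAbelian.exists_lagrangian_sq_eq_card Bℚ₂ haltℚ hndℚ
  have hw' : ∀ x, w (w x) = -x - w x := fun x ↦ by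
    rw [← sub_eq_zero, ← hwrel x]
    abel
  exact ⟨L, hLcard, isotropic_closure_descent Bℚ₂ B₂ r w hw' hbal h2B hwB L hLiso,
    coisotropic_closure_descent Bℚ₂ B₂ r w hw' hbal h2B hwB hsurj hprim L hLco⟩

end Package

end Summit.BirchSwinnertonDyer.BirchSwinnertonDyer.Theorems.SylvesterTwoCoupledTelescope
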